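import Summits.QuantumFields.BalabanUV.Beta.WilsonJetReflection2
import Summits.QuantumFields.BalabanUV.Beta.WilsonStencilDivergence

/-!
# The `(2,2)`-jet reflection law polarised in the background

HONEST FRAMING.  Discharging `BetaPertH` makes Balaban's ultraviolet stability UNCONDITIONAL — a real constructive-QFT
result; it is NOT the continuum limit and NOT the Clay problem.  This leaf is bookkeeping toward ONE letter-level identity
(`(W-LET-S₂)`, the second Taylor order in the background) on the Wilson side of ONE binder (`hR`/`hW`) of the `(D1)` conjunct
of `BetaPertH` (cell pub-balaban, β sub-cell, lane an3): finite algebra over an arbitrary finite abelian lattice, every normed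
real algebra, every tracial real-linear functional; no estimate, no limit, nothing cited — every statement is kernel-proved here
([folklore] = standard finite algebra; no published theorem is quoted and no manuscript under audit is used).
HONEST DEPENDENCY.  continuum YM on `T⁴` ⇐ `BetaPertH` ∧ nine spine estimates (0/9 proved); `BetaPertH` ⇐ (D1) ∧ (D4) ∧ CAP+tail.
This file discharges NOTHING of `BetaPertH` and moves no wall statement.

THE CHAIN.  `WilsonJetReflection2.jet22_pull` is the `(2,2)`-jet law under the axis-reflection pull-back `pull σ e α`, with its
contact organised through the two contact directions `E = reflDir₁ W B α` (linear in `B`) and `D = reflDir₂ W B α` (quadratic in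
`B`).  Here it is POLARISED IN THE BACKGROUND: subtracting the law at `B₁`, at `B₂` from the law at `B₁ + B₂` isolates the part
bilinear in `(B₁, B₂)` — the two-bond table law — with the kinetic brackets of `jet20` converted to the KINETIC PAIRING
`⟪A, E⟫ := Σ_x Σ_(μ,ν) τ(lcurl A · lcurl E)` (§2).  §4 evaluates every ingredient at BOND LETTERS `bondLetter u κ Y`: the contact
directions of bond letters are bond letters on the reflected axis, and the kinetic pairing of a bond letter with a coordinate field
`field t v` (resp. another bond letter) is the curl–curl matrix `WilsonStencilDivergence.curlCurl` weighted by a trace of letters.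
§5: the leg-sum collapse against a bond indicator, and the coordinate fields of a delta / of coordinates cut to a bond as bond
letters.  The coordinate / entrywise reading (matrices on the leg space `Λ × (C × D)`) is `WilsonJetReflection2Entry`.
-/

namespace Summit.QuantumFields.BalabanUV.Beta.WilsonJetReflection2Polar

open Literature.MathematicalPhysics.QuantumFieldTheory.Balaban1983to89.Beta.PlaquetteVertex
open Literature.MathematicalPhysics.QuantumFieldTheory.Balaban1983to89.Beta.PlaquetteVertex2 (jet22)
open Literature.MathematicalPhysics.QuantumFieldTheory.Balaban1983to89.Beta.PlaquetteBackground (jet21_add_bg)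
open Summit.QuantumFields.BalabanUV.Beta.WilsonJetReflection (pull axComm)
open Summit.QuantumFields.BalabanUV.Beta.WilsonJetReflection2 (reflDir₁ reflDir₂ jet22_pull)
open Summit.QuantumFields.BalabanUV.Beta.WilsonReflectionFrame (sum_reindex₃)
open Summit.QuantumFields.BalabanUV.Beta.WilsonStencilDivergence (curlCurl)

/-! ## §1 Bookkeeping: additivity of the reflection data in the background -/

section Bookkeeping

variable {𝔸 : Type*} [NormedRing 𝔸] {Λ : Type*} [AddCommGroup Λ] {D : Type*} [DecidableEq D]
variable {σ : Λ → Λ} {e : D → Λ} {α : D}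

/-- the pull-back is additive. [folklore] -/
theorem pull_add (X X' : Λ → D → 𝔸) : pull σ e α (X + X') = pull σ e α X + pull σ e α X' := by
  funext x κ
  by_cases h : κ = α
  · simp only [pull, if_pos h, Pi.add_apply, neg_add]
  · simp only [pull, if_neg h, Pi.add_apply]

omit [AddCommGroup Λ] [DecidableEq D] in
/-- the `α`-commutator letter is additive in the background. [folklore] -/
theorem axComm_add (W B B' : Λ → D → 𝔸) (α : D) (y : Λ) :
    axComm W (B + B') α y = axComm W B α y + axComm W B' α y := by
  simp only [axComm, Pi.add_apply, add_mul, mul_add]; abel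

omit [AddCommGroup Λ] in
/-- the first contact direction is additive in the background. [folklore] -/
theorem reflDir₁_add (W B B' : Λ → D → 𝔸) (α : D) : reflDir₁ W (B + B') α = reflDir₁ W B α + reflDir₁ W B' α := by
  funext y κ
  by_cases h : κ = α
  · simp only [reflDir₁, if_pos h, Pi.add_apply, axComm_add]
  · simp only [reflDir₁, if_neg h, Pi.add_apply, add_zero]

end Bookkeeping

/-! ## §2 The kinetic pairing `⟪A, E⟫ = Σ_x Σ_(μ,ν) τ(lcurl A · lcurl E)` — the polarisation of `jet20` -/

section Kinetic

variable {𝔸 : Type*} [NormedRing 𝔸] [NormedAlgebra ℝ 𝔸]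
variable {Λ : Type*} [Fintype Λ] [AddCommGroup Λ] {D : Type*} [Fintype D]

/-- polarisation of the kinetic jet: `jet20(A + E) − jet20(A) − jet20(E) = ⟪A, E⟫` (τ tracial; `jet20` ignores its background
slot, carried here as arbitrary `B, B′, B″`). [folklore] -/
theorem jet20_polar (τ : 𝔸 →ₗ[ℝ] ℝ) (hτ : ∀ a b : 𝔸, τ (a * b) = τ (b * a)) (e : D → Λ) (A E B B' B'' : Λ → D → 𝔸) :
    jet20 ℝ τ e (A + E) B - jet20 ℝ τ e A B' - jet20 ℝ τ e E B'' = ∑ x, ∑ μ, ∑ ν, τ (lcurl e A x μ ν * lcurl e E x μ ν) := by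
  rw [jet20_eq ℝ τ hτ, jet20_eq ℝ τ hτ, jet20_eq ℝ τ hτ]
  simp only [← Finset.sum_sub_distrib]
  refine Finset.sum_congr rfl fun x _ => Finset.sum_congr rfl fun μ _ => Finset.sum_congr rfl fun ν _ => ?_
  rw [lcurl_add, add_mul, mul_add, mul_add, map_add, map_add, map_add, hτ (lcurl e E x μ ν) (lcurl e A x μ ν), smul_eq_mul,
    smul_eq_mul, smul_eq_mul]
  ring

/-- the kinetic jet is half the pairing of the field with itself: `2·jet20(A) = ⟪A, A⟫`. [folklore] -/
theorem two_mul_jet20 (τ : 𝔸 →ₗ[ℝ] ℝ) (hτ : ∀ a b : 𝔸, τ (a * b) = τ (b * a)) (e : D → Λ) (A B : Λ → D → 𝔸) :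
    2 * jet20 ℝ τ e A B = ∑ x, ∑ μ, ∑ ν, τ (lcurl e A x μ ν * lcurl e A x μ ν) := by
  rw [jet20_eq ℝ τ hτ, Finset.mul_sum]
  refine Finset.sum_congr rfl fun x _ => ?_
  rw [Finset.mul_sum]
  refine Finset.sum_congr rfl fun μ _ => ?_
  rw [Finset.mul_sum]
  refine Finset.sum_congr rfl fun ν _ => ?_
  rw [smul_eq_mul]; ring

/-- the pairing is additive on the left. [folklore] -/
theorem kin_add_left (τ : 𝔸 →ₗ[ℝ] ℝ) (e : D → Λ) (A A' E : Λ → D → 𝔸) :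
    ∑ x, ∑ μ, ∑ ν, τ (lcurl e (A + A') x μ ν * lcurl e E x μ ν)
      = ∑ x, ∑ μ, ∑ ν, τ (lcurl e A x μ ν * lcurl e E x μ ν) + ∑ x, ∑ μ, ∑ ν, τ (lcurl e A' x μ ν * lcurl e E x μ ν) := by
  simp only [lcurl_add, add_mul, map_add, Finset.sum_add_distrib]

/-- the pairing is additive on the right. [folklore] -/
theorem kin_add_right (τ : 𝔸 →ₗ[ℝ] ℝ) (e : D → Λ) (A E E' : Λ → D → 𝔸) :
    ∑ x, ∑ μ, ∑ ν, τ (lcurl e A x μ ν * lcurl e (E + E') x μ ν)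
      = ∑ x, ∑ μ, ∑ ν, τ (lcurl e A x μ ν * lcurl e E x μ ν) + ∑ x, ∑ μ, ∑ ν, τ (lcurl e A x μ ν * lcurl e E' x μ ν) := by
  simp only [lcurl_add, mul_add, map_add, Finset.sum_add_distrib]

/-- the pairing is subtractive on the right. [folklore] -/
theorem kin_sub_right (τ : 𝔸 →ₗ[ℝ] ℝ) (e : D → Λ) (A E E' : Λ → D → 𝔸) :
    ∑ x, ∑ μ, ∑ ν, τ (lcurl e A x μ ν * lcurl e (E - E') x μ ν)
      = ∑ x, ∑ μ, ∑ ν, τ (lcurl e A x μ ν * lcurl e E x μ ν) - ∑ x, ∑ μ, ∑ ν, τ (lcurl e A x μ ν * lcurl e E' x μ ν) := by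
  simp only [lcurl_sub, mul_sub, map_sub, Finset.sum_sub_distrib]

/-- the pairing is symmetric for a tracial `τ`. [folklore] -/
theorem kin_comm (τ : 𝔸 →ₗ[ℝ] ℝ) (hτ : ∀ a b : 𝔸, τ (a * b) = τ (b * a)) (e : D → Λ) (A E : Λ → D → 𝔸) :
    ∑ x, ∑ μ, ∑ ν, τ (lcurl e A x μ ν * lcurl e E x μ ν) = ∑ x, ∑ μ, ∑ ν, τ (lcurl e E x μ ν * lcurl e A x μ ν) :=
  Finset.sum_congr rfl fun _ _ => Finset.sum_congr rfl fun _ _ => Finset.sum_congr rfl fun _ _ => hτ _ _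

end Kinetic

/-! ## §3 The law (J₂) polarised in the background -/

section Polar

variable {𝔸 : Type*} [NormedRing 𝔸] [NormedAlgebra ℝ 𝔸]
variable {Λ : Type*} [Fintype Λ] [AddCommGroup Λ] {D : Type*} [Fintype D] [DecidableEq D]
variable {σ : Λ → Λ} {e : D → Λ} {α : D}

/-- **THE `(2,2)`-JET REFLECTION LAW, POLARISED IN THE BACKGROUND.**  For an axis-reflection-like site involution `σ`, all
fields `W, B₁, B₂`, with `Eᵢ = reflDir₁ W Bᵢ α`, `Dᵢ = reflDir₂ W Bᵢ α`, `D₁₂ = reflDir₂ W (B₁ + B₂) α`: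
`4·[jet22(pull W; pull B₁, pull B₂)]_bil = 4·[jet22(W; B₁, B₂)]_bil`
`  + 4·{[jet21(W + E₁ + E₂, Bⱼ) − jet21(E₁ + E₂, Bⱼ)]_{j=1,2} − [jet21(W + E₁, B₁) − jet21(E₁, B₁)] − [jet21(W + E₂, B₂) − jet21(E₂, B₂)]}`
`  + 2·⟪W, D₁₂ − D₁ − D₂⟫ + 4·⟪E₁, E₂⟫` (`[·]_bil` = value at `B₁ + B₂` minus values at `B₁`, `B₂`). [folklore] -/
theorem jet22_pull_polar (τ : 𝔸 →ₗ[ℝ] ℝ) (hτ : ∀ a b : 𝔸, τ (a * b) = τ (b * a)) (hσ : Function.Involutive σ)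
    (h₁ : ∀ x κ, κ ≠ α → σ (x + e κ) = σ x + e κ) (h₂ : ∀ x, σ (x + e α) = σ x - e α) (W B₁ B₂ : Λ → D → 𝔸) :
    4 * (jet22 ℝ τ e (pull σ e α W) (pull σ e α B₁ + pull σ e α B₂)
          - jet22 ℝ τ e (pull σ e α W) (pull σ e α B₁) - jet22 ℝ τ e (pull σ e α W) (pull σ e α B₂)) =
      4 * (jet22 ℝ τ e W (B₁ + B₂) - jet22 ℝ τ e W B₁ - jet22 ℝ τ e W B₂)
      + 4 * ((jet21 ℝ τ e (W + (reflDir₁ W B₁ α + reflDir₁ W B₂ α)) B₁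
                + jet21 ℝ τ e (W + (reflDir₁ W B₁ α + reflDir₁ W B₂ α)) B₂
                - jet21 ℝ τ e (reflDir₁ W B₁ α + reflDir₁ W B₂ α) B₁ - jet21 ℝ τ e (reflDir₁ W B₁ α + reflDir₁ W B₂ α) B₂)
              - (jet21 ℝ τ e (W + reflDir₁ W B₁ α) B₁ - jet21 ℝ τ e (reflDir₁ W B₁ α) B₁)
              - (jet21 ℝ τ e (W + reflDir₁ W B₂ α) B₂ - jet21 ℝ τ e (reflDir₁ W B₂ α) B₂))
      + 2 * ∑ x, ∑ μ, ∑ ν, τ (lcurl e W x μ ν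
              * lcurl e (reflDir₂ W (B₁ + B₂) α - reflDir₂ W B₁ α - reflDir₂ W B₂ α) x μ ν)
      + 4 * ∑ x, ∑ μ, ∑ ν, τ (lcurl e (reflDir₁ W B₁ α) x μ ν * lcurl e (reflDir₁ W B₂ α) x μ ν) := by
  have h := jet22_pull ℝ τ hτ hσ h₁ h₂ W (B₁ + B₂)
  have h1 := jet22_pull ℝ τ hτ hσ h₁ h₂ W B₁
  have h2 := jet22_pull ℝ τ hτ hσ h₁ h₂ W B₂
  simp only [smul_eq_mul] at h h1 h2
  rw [pull_add, reflDir₁_add, jet21_add_bg ℝ τ hτ, jet21_add_bg ℝ τ hτ, jet21_add_bg ℝ τ hτ] at h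
  -- the kinetic brackets are pairings
  have k := jet20_polar τ hτ e W (reflDir₂ W (B₁ + B₂) α) (B₁ + B₂) (B₁ + B₂) (B₁ + B₂)
  have k1 := jet20_polar τ hτ e W (reflDir₂ W B₁ α) B₁ B₁ B₁
  have k2 := jet20_polar τ hτ e W (reflDir₂ W B₂ α) B₂ B₂ B₂
  have ks : (∑ x, ∑ μ, ∑ ν, τ (lcurl e W x μ ν * lcurl e (reflDir₂ W (B₁ + B₂) α - reflDir₂ W B₁ α - reflDir₂ W B₂ α) x μ ν))
      = (∑ x, ∑ μ, ∑ ν, τ (lcurl e W x μ ν * lcurl e (reflDir₂ W (B₁ + B₂) α) x μ ν))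
        - (∑ x, ∑ μ, ∑ ν, τ (lcurl e W x μ ν * lcurl e (reflDir₂ W B₁ α) x μ ν))
        - (∑ x, ∑ μ, ∑ ν, τ (lcurl e W x μ ν * lcurl e (reflDir₂ W B₂ α) x μ ν)) := by
    rw [kin_sub_right, kin_sub_right]
  have q := two_mul_jet20 τ hτ e (reflDir₁ W B₁ α + reflDir₁ W B₂ α) (B₁ + B₂)
  rw [kin_add_left, kin_add_right, kin_add_right, kin_comm τ hτ e (reflDir₁ W B₂ α) (reflDir₁ W B₁ α)] at q
  have q1 := two_mul_jet20 τ hτ e (reflDir₁ W B₁ α) B₁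
  have q2 := two_mul_jet20 τ hτ e (reflDir₁ W B₂ α) B₂
  linear_combination h - h1 - h2 + 2 * k - 2 * k1 - 2 * k2 - 2 * ks + 2 * q - 2 * q1 - 2 * q2

end Polar

/-! ## §4 Evaluations at bond letters -/

section BondLetters

variable {𝔸 : Type*} [NormedRing 𝔸] [NormedAlgebra ℝ 𝔸]
variable {Λ : Type*} [Fintype Λ] [DecidableEq Λ] [AddCommGroup Λ] {C : Type*} [Fintype C] {D : Type*} [Fintype D]
  [DecidableEq D] {e : D → Λ} {α : D}

omit [NormedAlgebra ℝ 𝔸] [Fintype Λ] [AddCommGroup Λ] [Fintype C] [Fintype D] in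
/-- the `α`-commutator letter of a field against a bond letter: supported at the bond's site, nonzero only if the bond points
along the reflected axis. [folklore] -/
theorem axComm_bondLetter (W : Λ → D → 𝔸) (u : Λ) (κ : D) (Y : 𝔸) (y : Λ) :
    axComm W (bondLetter u κ Y) α y = if y = u ∧ α = κ then Y * W u α - W u α * Y else 0 := by
  simp only [axComm, bondLetter]
  by_cases h : y = u ∧ α = κ
  · rw [if_pos h, if_pos h, h.1]
  · rw [if_neg h, if_neg h, zero_mul, mul_zero, sub_zero]

omit [NormedAlgebra ℝ 𝔸] [Fintype Λ] [AddCommGroup Λ] [Fintype C] [Fintype D] in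
/-- the first contact direction of a bond letter is a bond letter on the reflected axis: `E = bondLetter u α ([κ = α]·[Y, W_α(u)])`.
[folklore] -/
theorem reflDir₁_bondLetter (W : Λ → D → 𝔸) (u : Λ) (κ : D) (Y : 𝔸) :
    reflDir₁ W (bondLetter u κ Y) α = bondLetter u α (if α = κ then Y * W u α - W u α * Y else 0) := by
  funext y k
  simp only [reflDir₁, axComm_bondLetter, bondLetter]
  by_cases hk : k = α <;> by_cases hy : y = u <;> by_cases hκ : α = κ <;> simp [hk, hy, hκ]

omit [NormedAlgebra ℝ 𝔸] [Fintype Λ] [AddCommGroup Λ] [Fintype C] [Fintype D] in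
/-- **the polarised second contact direction of two bond letters** is a bond letter on the reflected axis: it vanishes unless the
two bonds are the SAME `α`-bond `(u, α)`, where its letter is `(ad_{Y₁} ad_{Y₂} + ad_{Y₂} ad_{Y₁}) W_α(u)`. [folklore] -/
theorem reflDir₂_polar_bondLetter (W : Λ → D → 𝔸) (u₁ u₂ : Λ) (κ₁ κ₂ : D) (Y₁ Y₂ : 𝔸) :
    reflDir₂ W (bondLetter u₁ κ₁ Y₁ + bondLetter u₂ κ₂ Y₂) α - reflDir₂ W (bondLetter u₁ κ₁ Y₁) α
        - reflDir₂ W (bondLetter u₂ κ₂ Y₂) α =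
      bondLetter u₁ α (if u₁ = u₂ ∧ α = κ₁ ∧ α = κ₂ then
        Y₁ * (Y₂ * W u₁ α - W u₁ α * Y₂) - (Y₂ * W u₁ α - W u₁ α * Y₂) * Y₁
          + (Y₂ * (Y₁ * W u₁ α - W u₁ α * Y₁) - (Y₁ * W u₁ α - W u₁ α * Y₁) * Y₂) else 0) := by
  have cross : ∀ b₁ b₂ a₁ a₂ : 𝔸, (b₁ + b₂) * (a₁ + a₂) - (a₁ + a₂) * (b₁ + b₂) - (b₁ * a₁ - a₁ * b₁) - (b₂ * a₂ - a₂ * b₂)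
      = (b₁ * a₂ - a₂ * b₁) + (b₂ * a₁ - a₁ * b₂) := by
    intros; noncomm_ring
  funext y k
  simp only [Pi.sub_apply, reflDir₂, Pi.add_apply, axComm_add]
  by_cases hk : k = α
  · rw [if_pos hk, if_pos hk, if_pos hk, cross]
    simp only [axComm_bondLetter, bondLetter, hk, and_true]
    by_cases h₁ : y = u₁
    · subst h₁
      by_cases h₂ : y = u₂
      · subst h₂
        by_cases e₁ : α = κ₁
        · subst e₁
          by_cases e₂ : α = κ₂
          · subst e₂; simp
          · simp [e₂]
        · simp [e₁]
      · simp [h₂]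
    · simp [h₁]
  · simp only [sub_zero, bondLetter, hk, and_false, if_false]

/-- a commutator with a coordinate combination is the coordinate combination of the commutators. [folklore] -/
theorem conj_sum (Y : 𝔸) (t : C → 𝔸) (c : C → ℝ) :
    Y * (∑ b, c b • t b) - (∑ b, c b • t b) * Y = ∑ b, c b • (Y * t b - t b * Y) := by
  simp only [Finset.mul_sum, Finset.sum_mul, mul_smul_comm, smul_mul_assoc, smul_sub, Finset.sum_sub_distrib]

omit [Fintype Λ] [Fintype C] [Fintype D] in
/-- the curl of a bond letter is the curl of the bond's indicator, times the letter. [folklore] -/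
theorem lcurl_bondLetter (z : Λ) (γ : D) (Z : 𝔸) (x : Λ) (μ ν : D) :
    lcurl e (bondLetter z γ Z) x μ ν = lcurl e (fun y κ => (Pi.single (z, γ) (1 : ℝ) : Λ × D → ℝ) (y, κ)) x μ ν • Z := by
  have h : bondLetter z γ Z = fun y κ => (Pi.single (z, γ) (1 : ℝ) : Λ × D → ℝ) (y, κ) • Z := by
    funext y κ
    simp only [bondLetter, Pi.single_apply, Prod.mk.injEq]
    split_ifs <;> simp
  rw [h]
  simp only [lcurl, sub_smul]

omit [Fintype C] in
/-- the curl of the coordinates is the coordinate combination of the curls of the bond indicators. [folklore] -/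
theorem lcurl_coords_eq_sum (v : Λ × (C × D) → ℝ) (x : Λ) (μ ν : D) (a : C) :
    lcurl e (coords v) x μ ν a
      = ∑ p : Λ × D, v (p.1, (a, p.2)) * lcurl e (fun y κ => (Pi.single p (1 : ℝ) : Λ × D → ℝ) (y, κ)) x μ ν := by
  simp only [lcurl, coords, Pi.sub_apply, Pi.single_apply, mul_sub, Finset.sum_sub_distrib, mul_ite, mul_one, mul_zero,
    Finset.sum_ite_eq, Finset.mem_univ, if_true]

omit [Fintype C] in
/-- **the kinetic pairing of two bond letters** is the trace of the letters times the curl–curl matrix: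
`⟪bondLetter u γ Z, bondLetter u′ γ′ Z′⟫ = τ(Z Z′)·curlCurl e (u,γ) (u′,γ′)`. [folklore] -/
theorem kin_bondLetter_bondLetter (τ : 𝔸 →ₗ[ℝ] ℝ) (u u' : Λ) (γ γ' : D) (Z Z' : 𝔸) :
    ∑ x, ∑ μ, ∑ ν, τ (lcurl e (bondLetter u γ Z) x μ ν * lcurl e (bondLetter u' γ' Z') x μ ν)
      = τ (Z * Z') * curlCurl e (u, γ) (u', γ') := by
  simp only [lcurl_bondLetter, smul_mul_assoc, mul_smul_comm, smul_smul, map_smul, smul_eq_mul, curlCurl, Finset.mul_sum]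
  refine Finset.sum_congr rfl fun x _ => Finset.sum_congr rfl fun μ _ => Finset.sum_congr rfl fun ν _ => ?_
  ring

/-- **the kinetic pairing of a coordinate field with a bond letter** is a linear form in the coordinates with the curl–curl
matrix as coefficient: `⟪field t v, bondLetter u γ Z⟫ = Σ_P v_P · τ(t_{P.c} Z) · curlCurl e (P.site, P.dir) (u, γ)`. [folklore] -/
theorem kin_field_bondLetter (τ : 𝔸 →ₗ[ℝ] ℝ) (t : C → 𝔸) (v : Λ × (C × D) → ℝ) (u : Λ) (γ : D) (Z : 𝔸) :
    ∑ x, ∑ μ, ∑ ν, τ (lcurl e (field t v) x μ ν * lcurl e (bondLetter u γ Z) x μ ν)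
      = ∑ P : Λ × (C × D), v P * (τ (t P.2.1 * Z) * curlCurl e (P.1, P.2.2) (u, γ)) := by
  simp only [curlCurl, Finset.mul_sum]
  conv_rhs => rw [Finset.sum_comm]
  refine Finset.sum_congr rfl fun x _ => ?_
  conv_rhs => rw [Finset.sum_comm]
  refine Finset.sum_congr rfl fun μ _ => ?_
  conv_rhs => rw [Finset.sum_comm]
  refine Finset.sum_congr rfl fun ν _ => ?_
  rw [lcurl_field, lcurl_bondLetter, Finset.sum_mul, map_sum, sum_reindex₃]
  conv_rhs => rw [Finset.sum_comm]
  refine Finset.sum_congr rfl fun a _ => ?_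
  rw [smul_mul_assoc, mul_smul_comm, smul_smul, map_smul, smul_eq_mul, lcurl_coords_eq_sum, Finset.sum_mul, Finset.sum_mul]
  refine Finset.sum_congr rfl fun p _ => ?_
  simp only [Prod.mk.eta]
  ring

end BondLetters

/-! ## §5 Coordinates cut to a bond: the leg-sum collapse, deltas and conjugated cuts as bond letters -/

section Cuts

variable {𝔸 : Type*} [NormedRing 𝔸] [NormedAlgebra ℝ 𝔸] {Λ : Type*} [DecidableEq Λ] {D : Type*} [DecidableEq D]

/-- collapse of a leg sum against the indicator of the bond `(u, γ)`. [folklore] -/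
theorem sum_cut [Fintype Λ] [Fintype D] {C : Type*} [Fintype C] (u : Λ) (γ : D) (f : C → ℝ) (v : Λ × (C × D) → ℝ) :
    ∑ Q : Λ × (C × D), (if Q.1 = u ∧ Q.2.2 = γ then f Q.2.1 else 0) * v Q = ∑ b, f b * v (u, (b, γ)) := by
  rw [Fintype.sum_prod_type, Finset.sum_eq_single u]
  · rw [Fintype.sum_prod_type]
    refine Finset.sum_congr rfl fun b _ => ?_
    rw [Finset.sum_eq_single γ]
    · simp
    · intro δ _ hδ; simp [hδ]
    · intro h; exact absurd (Finset.mem_univ _) h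
  · intro x _ hx; simp [hx]
  · intro h; exact absurd (Finset.mem_univ _) h

/-- the coordinate field of a scaled delta is the scaled bond letter: `field T (s·δ_{(u,(c,κ))}) = bondLetter u κ (s • T c)`.
[folklore] -/
theorem field_single {C' : Type*} [Fintype C'] [DecidableEq C'] (T : C' → 𝔸) (u : Λ) (c : C') (κ : D) (s : ℝ) :
    field T (Pi.single (u, (c, κ)) s) = bondLetter u κ (s • T c) := by
  funext x k
  simp only [field, bondLetter]
  by_cases h : x = u ∧ k = κ
  · obtain ⟨rfl, rfl⟩ := h
    rw [if_pos ⟨rfl, rfl⟩, Finset.sum_eq_single c, Pi.single_eq_same]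
    · intro c' _ hc
      rw [Pi.single_eq_of_ne (fun h' => hc (by simpa using h')), zero_smul]
    · intro h'; exact absurd (Finset.mem_univ _) h'
  · rw [if_neg h]
    refine Finset.sum_eq_zero fun c' _ => ?_
    rw [Pi.single_eq_of_ne, zero_smul]
    intro h'
    apply h
    simp only [Prod.mk.injEq] at h'
    exact ⟨h'.1, h'.2.2⟩

/-- **the conjugate of the coordinate field of the coordinates cut to the bond `(u, α)` (under the switch `c`) is the bond letter
`bondLetter u α ([c]·(Y·W_α(u) − W_α(u)·Y))`**, `W = field t v` — the shape of the first contact direction of a bond letter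
(`reflDir₁_bondLetter`). [folklore] -/
theorem conj_field_cut {C : Type*} [Fintype C] {α : D} (t : C → 𝔸) (Y : 𝔸) (v : Λ × (C × D) → ℝ) (u : Λ) (c : Prop)
    [Decidable c] :
    (fun x k => Y * field t (fun P : Λ × (C × D) => if P.1 = u ∧ P.2.2 = α ∧ c then v P else 0) x k
        - field t (fun P : Λ × (C × D) => if P.1 = u ∧ P.2.2 = α ∧ c then v P else 0) x k * Y) =
      bondLetter u α (if c then Y * field t v u α - field t v u α * Y else 0) := by
  funext x k
  have hf : field t (fun P : Λ × (C × D) => if P.1 = u ∧ P.2.2 = α ∧ c then v P else 0) x k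
      = if x = u ∧ k = α ∧ c then field t v x k else 0 := by
    by_cases h : x = u ∧ k = α ∧ c
    · simp only [field, if_pos h]
    · simp only [field, if_neg h, zero_smul, Finset.sum_const_zero]
  simp only [hf, bondLetter]
  by_cases hx : x = u
  · subst hx
    by_cases hk : k = α
    · subst hk
      by_cases hc : c
      · simp [hc]
      · simp [hc]
    · simp [hk]
  · simp [hx]

end Cuts

end Summit.QuantumFields.BalabanUV.Beta.WilsonJetReflection2Polar
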